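import Mathlib
import HarnessLib
import Summits.ValiantsHypothesis.ValiantsHypothesis.Theorems.MonotoneRestorationMonotoneRestorationQPLinearWidthGlue
import Summits.ValiantsHypothesis.ValiantsHypothesis.Theorems.MonotoneRestorationOrbitRestorationQPPerNotNarrow

/-!
# Route MonotoneRestoration, crux `MonotoneRestorationQP` (stmt-15886), line `linear_width` — (Q1) IS AT LEAST
# RUNG-STRENGTH: "DETERMINED ⇒ NARROW" closes the rung, GAP 1 and `WidthRestorationQP`, with NO `VP` hypothesis

Helper file (`--supports stmt-ValiantsHypothesis-15886`), def-free.  The algebraic question (Q1) of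
`…LinearWidthDeterminedVsNarrow.lean` / `…LinearWidthQ1Bridge.lean` (−2 g1; typed there verbatim as the hypothesis
`hQ1`: at every level `n` and width `k`, a polynomial determined by `HomIndist n k` lies in the span of the `hom_{F,n}`
with `tw F ≤ k`) was sized "M–L" in the census.  This file calibrates it from below, by name:

* `qpOrbitSymm_of_polylogHomDetermined_of_Q1` — under (Q1), EVERY polylog-hom-determined family (no matrix symmetry, no
  `VP`, no degree hypothesis) has square-symmetric circuits of quasi-polynomial orbit size: (Q1) turns determination
  into a narrow expansion, and the tree's K2/K3 `OrbitRestorationQPHomPolyClose.qpOrbit_of_mem_narrowSpan` turns a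
  narrow expansion into the circuits;
* `widthRestorationQP_of_Q1`, `widthRung_of_Q1`, `linearDegreeWidthRestoration_of_Q1` — hence (Q1) ALONE proves
  `WidthRestorationQP` (unfolded), every rung `WidthRung d`, in particular THE RUNG `stub_linearDegreeWidthRestoration`'s
  statement (`∀ c, WidthRung fun n => c * (n + 1)`) and GAP 1 `stub_degreeLifting`'s conclusion — the `VP` hypothesis
  idle throughout;
* `orbitRestorationQP_of_homDeterminedVP_of_Q1` — and with GAP 2 it gives L1 = `OrbitRestorationQP`.

So (Q1) is NOT a bookkeeping lemma between two width currencies: it contains the line's open RUNG (Dwivedi–Pago–Seppelt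
2026 Outlook, p. 12, "linear volume … an intriguing open problem") and the whole open converse of Dawar–Pago–Seppelt 2025
Thm 6.3 at quasi-polynomial scale, VP-free.  (In the regime `n ≥ deg` it moreover contains single-pattern
linear-volume homomorphism-distinguishing closedness with complex weights; see evidence SIMPLE-GRAPH-CUT-g3.md.)
Honest label: calibration; no stub closed; (Q1), the rung, the cruxes and VP ≠ VNP NOT moved.
[cite: DwivediPagoSeppelt2026, Def. 3.2, Outlook p. 12; DawarPagoSeppelt2025, Thm 6.3, §5]
-/

-- `Summit.ValiantsHypothesis.ValiantsHypothesis.…` is the tree's mandated namespace (Sub = Summit).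
set_option linter.dupNamespace false

noncomputable section

namespace Summit.ValiantsHypothesis.ValiantsHypothesis.Theorems

namespace Q1Calibration

open Summit.ValiantsHypothesis.ValiantsHypothesis.Theses.MonotoneRestoration
open Literature.Computability.AlgebraicComplexity
open MonotoneRestorationQPLinearWidth
open MvPolynomial

/-- **(Q1) ⇒ DETERMINED families are RESTORABLE — no symmetry, `VP` or degree hypothesis.**  If at every level and
width a `HomIndist n k`-determined polynomial lies in the span of the hom polynomials of treewidth `≤ k`, then every
`PolylogHomDetermined` family has square-symmetric circuits of orbit size `≤ 2^{(log₂ n + c + 3)^{c+3}}`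
(K2/K3, `qpOrbit_of_mem_narrowSpan`). [folklore] -/
theorem qpOrbitSymm_of_polylogHomDetermined_of_Q1
    (hQ1 : ∀ (n k : ℕ) (p : MvPolynomial (Fin n × Fin n) ℂ),
      (∀ A B : Fin n × Fin n → ℂ,
        (∀ (a b : ℕ) (E : Multiset (Fin a × Fin b)),
          Literature.Combinatorics.SimpleGraph.treewidth
            (SimpleGraph.fromRel fun u v : Fin a ⊕ Fin b =>
              ∃ p ∈ E, u = Sum.inl p.1 ∧ v = Sum.inr p.2) < k →
          eval A (homPoly E n ℂ) = eval B (homPoly E n ℂ)) →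
        eval A p = eval B p) →
      p ∈ Submodule.span ℂ
        {q : MvPolynomial (Fin n × Fin n) ℂ | ∃ (a b : ℕ) (E : Multiset (Fin a × Fin b)),
          Literature.Combinatorics.SimpleGraph.treewidth
              (SimpleGraph.fromRel fun u v : Fin a ⊕ Fin b =>
                ∃ e ∈ E, u = Sum.inl e.1 ∧ v = Sum.inr e.2) ≤ k ∧
            q = homPoly E n ℂ})
    (f : (n : ℕ) → MvPolynomial (Fin n × Fin n) ℂ) (hdet : PolylogHomDetermined f) : QPOrbitSymm f := by
  obtain ⟨c, hc⟩ := hdet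
  exact ⟨c + 3, fun n =>
    OrbitRestorationQPHomPolyClose.qpOrbit_of_mem_narrowSpan f c (fun n => hQ1 n _ (f n) (hc n)) n⟩

/-- **(Q1) ⇒ `WidthRestorationQP`** (unfolded; the matrix-symmetry and `VP` hypotheses are idle). [folklore] -/
theorem widthRestorationQP_of_Q1
    (hQ1 : ∀ (n k : ℕ) (p : MvPolynomial (Fin n × Fin n) ℂ),
      (∀ A B : Fin n × Fin n → ℂ,
        (∀ (a b : ℕ) (E : Multiset (Fin a × Fin b)),
          Literature.Combinatorics.SimpleGraph.treewidth
            (SimpleGraph.fromRel fun u v : Fin a ⊕ Fin b =>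
              ∃ p ∈ E, u = Sum.inl p.1 ∧ v = Sum.inr p.2) < k →
          eval A (homPoly E n ℂ) = eval B (homPoly E n ℂ)) →
        eval A p = eval B p) →
      p ∈ Submodule.span ℂ
        {q : MvPolynomial (Fin n × Fin n) ℂ | ∃ (a b : ℕ) (E : Multiset (Fin a × Fin b)),
          Literature.Combinatorics.SimpleGraph.treewidth
              (SimpleGraph.fromRel fun u v : Fin a ⊕ Fin b =>
                ∃ e ∈ E, u = Sum.inl e.1 ∧ v = Sum.inr e.2) ≤ k ∧
            q = homPoly E n ℂ}) :
    ∀ f : (n : ℕ) → MvPolynomial (Fin n × Fin n) ℂ,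
      IsMatrixSymmetric f → IsVPFamily f → PolylogHomDetermined f → QPOrbitSymm f :=
  fun f _ _ hdet => qpOrbitSymm_of_polylogHomDetermined_of_Q1 hQ1 f hdet

/-- **(Q1) ⇒ every rung `WidthRung d`** of line `linear_width`. [folklore] -/
theorem widthRung_of_Q1
    (hQ1 : ∀ (n k : ℕ) (p : MvPolynomial (Fin n × Fin n) ℂ),
      (∀ A B : Fin n × Fin n → ℂ,
        (∀ (a b : ℕ) (E : Multiset (Fin a × Fin b)),
          Literature.Combinatorics.SimpleGraph.treewidth
            (SimpleGraph.fromRel fun u v : Fin a ⊕ Fin b =>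
              ∃ p ∈ E, u = Sum.inl p.1 ∧ v = Sum.inr p.2) < k →
          eval A (homPoly E n ℂ) = eval B (homPoly E n ℂ)) →
        eval A p = eval B p) →
      p ∈ Submodule.span ℂ
        {q : MvPolynomial (Fin n × Fin n) ℂ | ∃ (a b : ℕ) (E : Multiset (Fin a × Fin b)),
          Literature.Combinatorics.SimpleGraph.treewidth
              (SimpleGraph.fromRel fun u v : Fin a ⊕ Fin b =>
                ∃ e ∈ E, u = Sum.inl e.1 ∧ v = Sum.inr e.2) ≤ k ∧
            q = homPoly E n ℂ})
    (d : ℕ → ℕ) : WidthRung d :=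
  widthRung_of_top (widthRestorationQP_of_Q1 hQ1) d

/-- **(Q1) ⇒ THE RUNG** `stub_linearDegreeWidthRestoration`'s statement (`LinearDegreeWidthRestoration`, unfolded
Theorems-side as `∀ c, WidthRung fun n => c * (n + 1)`) — open in print (Dwivedi–Pago–Seppelt 2026 Outlook p. 12), so (Q1)
is at least rung-strength. [cite: DwivediPagoSeppelt2026, Outlook p. 12] -/
theorem linearDegreeWidthRestoration_of_Q1
    (hQ1 : ∀ (n k : ℕ) (p : MvPolynomial (Fin n × Fin n) ℂ),
      (∀ A B : Fin n × Fin n → ℂ,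
        (∀ (a b : ℕ) (E : Multiset (Fin a × Fin b)),
          Literature.Combinatorics.SimpleGraph.treewidth
            (SimpleGraph.fromRel fun u v : Fin a ⊕ Fin b =>
              ∃ p ∈ E, u = Sum.inl p.1 ∧ v = Sum.inr p.2) < k →
          eval A (homPoly E n ℂ) = eval B (homPoly E n ℂ)) →
        eval A p = eval B p) →
      p ∈ Submodule.span ℂ
        {q : MvPolynomial (Fin n × Fin n) ℂ | ∃ (a b : ℕ) (E : Multiset (Fin a × Fin b)),
          Literature.Combinatorics.SimpleGraph.treewidth
              (SimpleGraph.fromRel fun u v : Fin a ⊕ Fin b =>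
                ∃ e ∈ E, u = Sum.inl e.1 ∧ v = Sum.inr e.2) ≤ k ∧
            q = homPoly E n ℂ}) :
    ∀ c : ℕ, WidthRung fun n => c * (n + 1) :=
  fun c => widthRung_of_Q1 hQ1 fun n => c * (n + 1)

/-- **(Q1) + GAP 2 ⇒ L1.**  Under (Q1), the registered GAP 2 (`HomDeterminedVP`, unfolded) alone gives
`OrbitRestorationQP` (`orbitRestorationQP_of_width` with the width half supplied by (Q1)). [folklore] -/
theorem orbitRestorationQP_of_homDeterminedVP_of_Q1
    (hQ1 : ∀ (n k : ℕ) (p : MvPolynomial (Fin n × Fin n) ℂ),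
      (∀ A B : Fin n × Fin n → ℂ,
        (∀ (a b : ℕ) (E : Multiset (Fin a × Fin b)),
          Literature.Combinatorics.SimpleGraph.treewidth
            (SimpleGraph.fromRel fun u v : Fin a ⊕ Fin b =>
              ∃ p ∈ E, u = Sum.inl p.1 ∧ v = Sum.inr p.2) < k →
          eval A (homPoly E n ℂ) = eval B (homPoly E n ℂ)) →
        eval A p = eval B p) →
      p ∈ Submodule.span ℂ
        {q : MvPolynomial (Fin n × Fin n) ℂ | ∃ (a b : ℕ) (E : Multiset (Fin a × Fin b)),
          Literature.Combinatorics.SimpleGraph.treewidth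
              (SimpleGraph.fromRel fun u v : Fin a ⊕ Fin b =>
                ∃ e ∈ E, u = Sum.inl e.1 ∧ v = Sum.inr e.2) ≤ k ∧
            q = homPoly E n ℂ})
    (hGAP2 : ∀ f : (n : ℕ) → MvPolynomial (Fin n × Fin n) ℂ,
      IsMatrixSymmetric f → IsVPFamily f → PolylogHomDetermined f) :
    OrbitRestorationQP :=
  orbitRestorationQP_of_width (widthRestorationQP_of_Q1 hQ1) hGAP2

end Q1Calibration

end Summit.ValiantsHypothesis.ValiantsHypothesis.Theorems

end
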